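/-
Copyright (c) 2026. All rights reserved.
Released under Apache 2.0 license as described in the file LICENSE.
Authors: abc-iut cell, discharge seat abc-iut-w4-d095 (wave 4, gen 3).
-/
import Mathlib.Algebra.Category.Grp.Preadditive
import Mathlib.CategoryTheory.Preadditive.FunctorCategory
import Literature.AnabelianGeometry.AbsoluteAnabelian.LogFrobeniusLogWallOfObstruction
import Literature.AnabelianGeometry.AbsoluteAnabelian.LogFrobeniusLogWallPlusOfObstruction
import HarnessLib

/-!
# [AbsTopIII] Corollary 5.5 (iv), first sentence, PRINT-FAITHFUL form (`Cor55LogWall`, both observables `S_log`, `S_log⊞`): kernel NON-VACUITY over every index set with a place of either kind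

S. Mochizuki, *Topics in absolute anabelian geometry III: global reconstruction algorithms*,
J. Math. Sci. Univ. Tokyo 22 (2015) 939–1156 [MochizukiAbsTopIII2015]; locators `p.N` = pages of the
author's manuscript (`paper:url-5493eb38cbb7`): Def 5.4 (iii), (v), (vii) pp. 126–128; Cor 5.5 (iv) p. 131 ("`D•_{≤2}` does not
admit a structure of core on `D•_{≤1}` which is compatible with the observables `S_log`, `S_log⊞`"); Lemma 3.4 p. 74 / Lemma 4.4
p. 106 (the nonarchimedean / archimedean mechanisms).

PROOF companion of `LogFrobeniusObservables.lean` (abc-iut-L4-t3: the print-faithful log-wall `LogFrobeniusSetting.Cor55LogWall T`,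
over the `TS`-homotopies `T`, versus the formally STRONGER `⊞`-only `Cor55Incompatibility` = FACT-LIST F-0141, referee K1-F1) and of
abc-iut-w5-d097's reductions `cor55LogWall_of_incompatibility`, `cor55LogWall_of_nonarchObstruction` (`LogFrobeniusLogWallOfObstruction.lean`)
and `cor55Incompatibility_of_archObstruction` (`LogFrobeniusLogWallPlusOfObstruction.lean`).  This seat's p424770 calibrated the
`⊞`-only F-0141 at an ARCHIMEDEAN place; here the PRINT-FAITHFUL statement is shown SATISFIABLE together with the interface over every
index set having a place of EITHER kind:

* ARCHIMEDEAN place `v₀` (`exists_cor55LogWall_of_arch`): the zero-twisted diagonal setting (all rows one preadditive large category `C`,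
  all structure functors `𝟭 C`, every `ι⊞_{v,ε} := 0`) with the ZERO `TS`-homotopies (`ι_{v,ε} := 0`, printed requirement
  `iota_toTS` by `rfl`) satisfies w5-d097's archimedean cycle obstruction at any `x₀` with `𝟙 x₀ ≠ 0`, hence `Cor55Incompatibility`,
  hence the weaker `Cor55LogWall`.
* NONARCHIMEDEAN place `v₀` (`exists_cor55LogWall_of_nonarch`): at a nonarchimedean place the `⊞`-observable carries no arrow into
  the space-link vertex (`isEmpty_logEdge_spaceLink_of_eq_false`), so zero-twisting `ι⊞` does not help; instead the PLAIN diagonal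
  setting (`ι⊞_{v,ε}` the identity identifications) is equipped with the `TS`-homotopies `twistTS` that are the identity identifications
  on every arrow EXCEPT the space-link arrow `k̄^× ↪ k̄` of `Γ⃗^log_non` (Def 5.4 (iii); not in `Γ⃗^⋉_non`, so unconstrained by
  `iota_toTS`), where they are ZERO.  Then in w5-d097's nonarchimedean two-path obstruction the composite through
  `ι_{k̄^× ↪ k̄}` is `0` while `ι_{𝒪^× →(log) k~}` at `x₀` is the identity: `0 ≠ 𝟙 x₀` — the obstruction holds, hence `Cor55LogWall`.
* `exists_cor55LogWall` — over every NONEMPTY index set (instantiated at `AddCommGrpCat.{u}`, `x₀ := ℤ`).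

HONEST LABEL: DEGENERATE calibration witnesses (no arithmetic content; zero natural transformations are not print's `ι`, which are
induced by the arrows of Def 5.4 (iii)/(v)); they certify that the TYPED print-faithful log-wall is consistent with the interface and
that both of w5-d097's reductions have satisfiable antecedents.  Refereed pre-IUT anabelian geometry; nothing here bears on
[IUTchIII] Cor. 3.12; typed ≠ proved.
-/

universe u

open CategoryTheory

namespace Literature.AnabelianGeometry.AbsoluteAnabelian

namespace LogFrobeniusSetting

/-! ## Bookkeeping at the diagonal settings -/

section Lemmas

variable {C : Type (u + 1)} [Category.{u} C]

/-- `Λ_ν ∘ 𝟭 = 𝟭` for `log = 𝟭`. [cite: MochizukiAbsTopIII2015, Def 5.4 (vii) p. 128] -/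
theorem frobeniusTwist_id_comp_id_eq (b : Bool) : frobeniusTwist (𝟭 C) b ⋙ 𝟭 C = 𝟭 C := by
  cases b <;> rfl

/-- `(Λ_ν ∘ 𝟭) ∘ 𝟭 = 𝟭 ∘ 𝟭` for `log = 𝟭` (the `TS`-typing, one more forgetful functor).
[cite: MochizukiAbsTopIII2015, Def 5.4 (vii) p. 128] -/
theorem frobeniusTwist_id_comp_id_comp_id_eq (b : Bool) :
    (frobeniusTwist (𝟭 C) b ⋙ 𝟭 C) ⋙ 𝟭 C = 𝟭 C ⋙ 𝟭 C := by
  cases b <;> rfl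

/-- Whiskering an `eqToHom` of functors on the right is an `eqToHom`. [folklore] -/
private theorem whiskerRight_eqToHom' {A B B' : Type*} [Category A] [Category B] [Category B'] {F G : A ⥤ B}
    (h : F = G) (R : B ⥤ B') :
    Functor.whiskerRight (eqToHom h) R = eqToHom (show F ⋙ R = G ⋙ R by rw [h]) := by
  subst h
  rw [eqToHom_refl, Functor.whiskerRight_id', eqToHom_refl]

/-- A morphism `m : x ⟶ x` heterogeneously equal to a component of an `eqToHom` between functors equal to `𝟭` is the
identity. [folklore] -/
private theorem eq_id_of_heq_eqToHom_app {F G : C ⥤ C} (hF : F = 𝟭 C) (hG : G = 𝟭 C) (E : F = G) (x : C) (m : x ⟶ x)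
    (h : HEq m ((eqToHom E).app x)) : m = 𝟙 x := by
  subst hF hG
  rw [eqToHom_refl, NatTrans.id_app] at h
  exact eq_of_heq h

variable [Preadditive C]

/-- A morphism `m : x ⟶ x` heterogeneously equal to a component of the ZERO natural transformation between functors equal to
`𝟭` is zero. [folklore] -/
private theorem eq_zero_of_heq_zero_app {F G : C ⥤ C} (hF : F = 𝟭 C) (hG : G = 𝟭 C) (y x : C) (hy : y = x) (m : x ⟶ x)
    (h : HEq m ((0 : F ⟶ G).app y)) : m = 0 := by
  subst hF hG hy
  rw [NatTrans.app_zero] at h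
  exact eq_of_heq h

end Lemmas

/-! ## The `TS`-homotopies of the nonarchimedean witness -/

section TwistTS

variable (C : Type (u + 1)) [Category.{u} C] [Preadditive C]

/-- **The twisted `TS`-homotopies over the plain diagonal setting**: at an edge `ε : ν₁ → ν₂` of `Γ⃗^log_v`, the identity
identification `(Λ_{ν₁} ∘ 𝟭) ∘ 𝟭 = 𝟭 ∘ 𝟭` — EXCEPT at a NONARCHIMEDEAN place on the arrow into the space-link vertex (`k̄^× ↪ k̄`,
Def 5.4 (iii)), where it is the ZERO natural transformation.  [cite: MochizukiAbsTopIII2015, Def 5.4 (vii) p. 128] -/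
def twistTS (b : Bool) (ν₁ ν₂ : LogVertex b) (_ε : LogEdgeTS b ν₁ ν₂) :
    ((frobeniusTwist (𝟭 C) ν₁.isPostLog ⋙ 𝟭 C) ⋙ 𝟭 C ⟶ 𝟭 C ⋙ 𝟭 C) :=
  cond (!b && ν₂.isSpaceLink) 0 (eqToHom (frobeniusTwist_id_comp_id_comp_id_eq ν₁.isPostLog))

/-- The space-link vertex is the space-link vertex. [cite: MochizukiAbsTopIII2015, Def 5.4 (iii) p. 126] -/
theorem isSpaceLink_spaceLink (b : Bool) : (LogVertex.spaceLink b).isSpaceLink = true := by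
  cases b <;> rfl

/-- At a nonarchimedean place, `twistTS` vanishes on every arrow into the space-link vertex (stated for `b = false` to apply
at `b := isArc v₀` without transport). [cite: MochizukiAbsTopIII2015, Def 5.4 (iii) p. 126] -/
theorem twistTS_spaceLink_eq_zero (b : Bool) (hb : b = false) (ν : LogVertex b)
    (ε : LogEdgeTS b ν (LogVertex.spaceLink b)) : twistTS C b ν _ ε = 0 := by
  subst hb
  simp only [twistTS, isSpaceLink_spaceLink, Bool.not_false, Bool.and_self, cond_true]

/-- At a nonarchimedean place, `twistTS` is the identity identification on every arrow whose target receives an arrow from the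
post-log vertex (i.e. the target `k~` of the shell-arrow — not the space-link vertex).
[cite: MochizukiAbsTopIII2015, Def 5.4 (iii) p. 126] -/
theorem twistTS_eq_eqToHom (b : Bool) (hb : b = false) (νu νc : LogVertex b)
    (ε₃ : LogEdgeTS b (LogVertex.postLog b) νc) (ε₄ : LogEdgeTS b νu νc) :
    twistTS C b νu νc ε₄ = eqToHom (frobeniusTwist_id_comp_id_comp_id_eq νu.isPostLog) := by
  subst hb
  revert ε₄
  cases ε₃
  intro ε₄
  rfl

/-- `twistTS` on the arrows of `Γ⃗^⋉_v` (those carrying an `ι⊞`) is the identity identification: at an archimedean place always,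
at a nonarchimedean place because no `ι⊞`-arrow ends at the space-link vertex.
[cite: MochizukiAbsTopIII2015, Def 5.4 (vii) p. 128] -/
theorem twistTS_toTS (b : Bool) (ν₁ ν₂ : LogVertex b) (ε : LogEdge b ν₁ ν₂) :
    twistTS C b ν₁ ν₂ ε.toTS = eqToHom (frobeniusTwist_id_comp_id_comp_id_eq ν₁.isPostLog) := by
  cases b with
  | true => rfl
  | false =>
    unfold twistTS
    cases h : ν₂.isSpaceLink with
    | false => rfl
    | true =>
      exfalso
      have hν₂ : ν₂ = LogVertex.spaceLink false := by
        revert h; cases ν₂ <;> simp [LogVertex.isSpaceLink, LogVertex.spaceLink]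
      subst hν₂
      exact (isEmpty_logEdge_spaceLink_of_eq_false false rfl ν₁).false ε

end TwistTS

/-! ## The witnesses -/

variable (Vmod : Type u) (isArc : Vmod → Bool)

/-- **Print-faithful log-wall at an ARCHIMEDEAN place**: over a preadditive large category `C` with an object `x₀`, `𝟙 x₀ ≠ 0`,
the zero-twisted diagonal setting (every `ι⊞ := 0`) with the zero `TS`-homotopies satisfies `Cor55LogWall` — via the archimedean
cycle obstruction (`cor55Incompatibility_of_archObstruction`: the middle component is `0`, so the cycle composite is `0 ≠ 𝟙 x₀`) and
`cor55LogWall_of_incompatibility`.  DEGENERATE calibration witness. [cite: MochizukiAbsTopIII2015, Cor 5.5 (iv) p. 131] -/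
theorem exists_cor55LogWall_of_arch (C : Type (u + 1)) [Category.{u} C] [Preadditive C] (x₀ : C)
    (hx₀ : (𝟙 x₀ : x₀ ⟶ x₀) ≠ 0) (v₀ : Vmod) (hv₀ : isArc v₀ = true) :
    ∃ (L : LogFrobeniusSetting Vmod isArc) (T : L.TSHomotopies), L.X = C ∧ L.Cor55Incompatibility ∧ L.Cor55LogWall T := by
  let L₀ : LogFrobeniusSetting Vmod isArc :=
    { X := C
      E := C
      proj := 𝟭 C
      log := 𝟭 C
      logIsoId := Iso.refl _
      logOver := Iso.refl _
      Nplus := fun _ => C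
      N := fun _ => C
      forget := fun _ => 𝟭 C
      toE := fun _ => 𝟭 C
      lam := fun _ _ => 𝟭 C
      lamOver := fun _ _ => Iso.refl _
      lam_spaceLink_eq_postLog := fun _ => rfl
      iota := fun _ _ _ _ => 0
      An := C
      κAn := CategoryTheory.Equivalence.refl
      φAn := 𝟭 C
      φAn_isEquivalence := inferInstance
      ηAn := Iso.refl _
      κAn₂ := CategoryTheory.Equivalence.refl
      Emono := C
      monoAn := 𝟭 C
      NmonoPlus := fun _ => C
      Nmono := fun _ => C
      forgetMono := fun _ => 𝟭 C
      toEmono := fun _ => 𝟭 C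
      monoNplus := fun _ => 𝟭 C
      monoN := fun _ => 𝟭 C
      monoHomotopy := fun _ => Iso.refl _
      AnMono := C
      κAnMono := CategoryTheory.Equivalence.refl
      ψAnMono := fun _ _ => 𝟭 C }
  let T₀ : L₀.TSHomotopies :=
    { iota := fun _ _ _ _ => 0
      iota_toTS := fun _ _ _ _ => by ext; rfl }
  have hinc : L₀.Cor55Incompatibility := by
    refine L₀.cor55Incompatibility_of_archObstruction v₀ hv₀ x₀ ?_
    intro ν₂ νₘ _ _ ε₁ ε₂ ε₃ a _ m₁ m₂ m₃ _ hm₂ _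
    have h₂ : m₂ = 0 :=
      eq_zero_of_heq_zero_app (frobeniusTwist_id_comp_id_eq (C := C) ν₂.isPostLog) rfl _ x₀ rfl m₂ hm₂
    rw [h₂, Limits.zero_comp, Limits.comp_zero, Limits.comp_zero]
    exact fun h => hx₀ h.symm
  exact ⟨L₀, T₀, rfl, hinc, L₀.cor55LogWall_of_incompatibility T₀ hinc⟩

/-- **Print-faithful log-wall at a NONARCHIMEDEAN place**: over a preadditive large category `C` with an object `x₀`,
`𝟙 x₀ ≠ 0`, the PLAIN diagonal setting (`ι⊞` the identity identifications) with the `TS`-homotopies `twistTS` (identity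
identifications except ZERO on `k̄^× ↪ k̄`) satisfies w5-d097's nonarchimedean two-path obstruction — the composite
`λ(a) ≫ ι_{ε₁} ≫ ι_{ε₂} ≫ ι_{ε₃}` passes through `ι_{k̄^× ↪ k̄} = 0`, while `ι_{ε₄}` at `x₀` is the identity — hence `Cor55LogWall`.
DEGENERATE calibration witness. [cite: MochizukiAbsTopIII2015, Cor 5.5 (iv) p. 131] -/
theorem exists_cor55LogWall_of_nonarch (C : Type (u + 1)) [Category.{u} C] [Preadditive C] (x₀ : C)
    (hx₀ : (𝟙 x₀ : x₀ ⟶ x₀) ≠ 0) (v₀ : Vmod) (hv₀ : isArc v₀ = false) :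
    ∃ (L : LogFrobeniusSetting Vmod isArc) (T : L.TSHomotopies), L.X = C ∧ L.Cor55LogWall T := by
  let L₁ : LogFrobeniusSetting Vmod isArc :=
    { X := C
      E := C
      proj := 𝟭 C
      log := 𝟭 C
      logIsoId := Iso.refl _
      logOver := Iso.refl _
      Nplus := fun _ => C
      N := fun _ => C
      forget := fun _ => 𝟭 C
      toE := fun _ => 𝟭 C
      lam := fun _ _ => 𝟭 C
      lamOver := fun _ _ => Iso.refl _
      lam_spaceLink_eq_postLog := fun _ => rfl
      iota := fun _ ν₁ _ _ => eqToHom (frobeniusTwist_id_comp_id_eq ν₁.isPostLog)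
      An := C
      κAn := CategoryTheory.Equivalence.refl
      φAn := 𝟭 C
      φAn_isEquivalence := inferInstance
      ηAn := Iso.refl _
      κAn₂ := CategoryTheory.Equivalence.refl
      Emono := C
      monoAn := 𝟭 C
      NmonoPlus := fun _ => C
      Nmono := fun _ => C
      forgetMono := fun _ => 𝟭 C
      toEmono := fun _ => 𝟭 C
      monoNplus := fun _ => 𝟭 C
      monoN := fun _ => 𝟭 C
      monoHomotopy := fun _ => Iso.refl _
      AnMono := C
      κAnMono := CategoryTheory.Equivalence.refl
      ψAnMono := fun _ _ => 𝟭 C }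
  let T₁ : L₁.TSHomotopies :=
    { iota := fun v ν₁ ν₂ ε => twistTS C (isArc v) ν₁ ν₂ ε
      iota_toTS := fun v ν₁ ν₂ ε => by
        change twistTS C (isArc v) ν₁ ν₂ ε.toTS =
          Functor.whiskerRight (eqToHom (frobeniusTwist_id_comp_id_eq ν₁.isPostLog)) (𝟭 C)
        rw [twistTS_toTS, whiskerRight_eqToHom'] }
  refine ⟨L₁, T₁, rfl, L₁.cor55LogWall_of_nonarchObstruction T₁ v₀ hv₀ x₀ ?_⟩
  intro νu νm νc hu _ _ ε₁ ε₂ ε₃ ε₄ a _ m₁ m₂ m₃ m₄ _ hm₂ _ hm₄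
  -- `ι_{ε₂} = 0` (arrow into the space-link vertex at a nonarchimedean place)
  have h₂ : m₂ = 0 := by
    change HEq m₂ ((twistTS C (isArc v₀) νm _ ε₂).app _) at hm₂
    rw [twistTS_spaceLink_eq_zero C (isArc v₀) hv₀] at hm₂
    exact eq_zero_of_heq_zero_app (frobeniusTwist_id_comp_id_comp_id_eq (C := C) νm.isPostLog) rfl _ x₀ rfl m₂ hm₂
  -- `ι_{ε₄}` at `x₀` is the identity
  have h₄ : m₄ = 𝟙 x₀ := by
    change HEq m₄ ((twistTS C (isArc v₀) νu νc ε₄).app x₀) at hm₄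
    rw [twistTS_eq_eqToHom C (isArc v₀) hv₀ νu νc ε₃ ε₄] at hm₄
    exact eq_id_of_heq_eqToHom_app (frobeniusTwist_id_comp_id_comp_id_eq (C := C) νu.isPostLog) rfl _ x₀ m₄ hm₄
  rw [h₂, h₄, Limits.zero_comp, Limits.comp_zero, Limits.comp_zero]
  exact fun h => hx₀ h.symm

/-- `𝟙_ℤ ≠ 0` in `AddCommGrpCat.{u}`. [folklore] -/
private theorem id_ulift_int_ne_zero :
    (𝟙 (AddCommGrpCat.of (ULift.{u} ℤ)) : AddCommGrpCat.of (ULift.{u} ℤ) ⟶ AddCommGrpCat.of (ULift.{u} ℤ)) ≠ 0 := by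
  intro h
  have h1 := congrArg (fun f : AddCommGrpCat.of (ULift.{u} ℤ) ⟶ AddCommGrpCat.of (ULift.{u} ℤ) =>
    (f.hom (ULift.up 1)).down) h
  simp at h1

/-- **The print-faithful log-wall `Cor55LogWall` is satisfiable over every NONEMPTY index set**: given any place `v₀`, at the
archimedean or the nonarchimedean witness over `AddCommGrpCat.{u}` (`x₀ := ℤ`) according to `isArc v₀`.
[cite: MochizukiAbsTopIII2015, Cor 5.5 (iv) p. 131] -/
theorem exists_cor55LogWall (v₀ : Vmod) :
    ∃ (L : LogFrobeniusSetting Vmod isArc) (T : L.TSHomotopies), L.Cor55LogWall T := by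
  cases h : isArc v₀ with
  | true =>
    obtain ⟨L, T, -, -, hL⟩ := exists_cor55LogWall_of_arch Vmod isArc AddCommGrpCat.{u} _ id_ulift_int_ne_zero v₀ h
    exact ⟨L, T, hL⟩
  | false =>
    obtain ⟨L, T, -, hL⟩ := exists_cor55LogWall_of_nonarch Vmod isArc AddCommGrpCat.{u} _ id_ulift_int_ne_zero v₀ h
    exact ⟨L, T, hL⟩

end LogFrobeniusSetting

end Literature.AnabelianGeometry.AbsoluteAnabelian
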